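import Literature.AlgebraicGeometry.AbelianSchemes.AbelianSchemeDualTransport
import Literature.AlgebraicGeometry.AbelianSchemes.AbelianSchemeDualRingAction
import HarnessLib

/-!
# The dual transport of an isomorphism is the dual homomorphism of its inverse: `Ĥ_e = (e⁻¹)^∨`; the `λ`-clause of an
# isomorphism of triples from the dual-homomorphism form `e ≫ λ ≫ e^∨ = λ′`

Topic `AlgebraicGeometry/AbelianSchemes`; namespace `Literature.AlgebraicGeometry.AbelianSchemes.AbelianSchemeOver.DualPair`.
THEOREMS ONLY (no def, no instance, no notation, no named fact, no `sorry`).  Cell hodgecm-mathlib (D-0151), P6 «MOD programme»,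
sub-desk P6a, brick (T) of the `stub_HFROB` junction, part 1∕3 (A-p03 (g30), 2026-09-01).  HC_CM is proved only modulo the printed
citations until rung 0 closes; nothing here is about HC.

[MilneAV2008] I §8 (pp. 36–37): the dual `(A^∨, 𝒫)` is characterised by «a unique regular map `α : T → A^∨` such that
`(1 × α)^*𝒫 ≈ ℒ`»; [MumfordAV1970] §15 Thm. 1 ∕ [MilneAV2008] I §9: `f^∨` classifies `(f × 1)^*𝒫_B` and `f ↦ f^∨` is functorial.
The tree has TWO classifying maps attached to an isomorphism of `S`-group schemes `e : A′ ≅ A` with dual pairs `D′, D`: the dual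
TRANSPORT ★ `DualPair.hatTransport D D′ e : Â′ → Â` (classifying `(e⁻¹ × 1)^*𝒫′`, ★ `AbelianSchemeDualTransport`; it carries the
Poincaré clause `(e × Ĥ_e)^*𝒫 ≅ 𝒫′` and the `X̂`-clause of [MumfordFogartyKirwan1994] Def. 7.3) and the dual HOMOMORPHISM ★
`DualPair.dualIsogeny e⁻¹ D D′` (classifying `(e⁻¹ × 1_{Â′})^*𝒫′`, ★ `AbelianSchemeDualIsogeny`; it carries the calculus `(ψ ≫ χ)^∨ =
χ^∨ ≫ ψ^∨`, `𝟙^∨ = 𝟙`).  They are EQUAL (`hatTransport_eq_dualIsogeny_inv`, uniqueness ★ `eq_dualIsogeny`), hence `e^∨ ≫ Ĥ_e = 𝟙`,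
`Ĥ_e ≫ e^∨ = 𝟙` (over a reduced locally Noetherian base, with `𝒫|_{A × {ε}} ≅ 𝒪`), and the `λ`-CLAUSE `λ′ ≫ Ĥ_e = e ≫ λ` of an
isomorphism of triples follows from the dual-homomorphism form `e ≫ λ ≫ e^∨ = λ′` in which roof ∕ Frobenius computations (★
`Roof₀`, ★ `FrobCover₀` shapes) deliver exactness on polarisations (`lam_left_comp_hatTransport_of_comp_dualIsogenyOver_eq`).

## References
* [MilneAV2008] J. S. Milne, *Abelian Varieties* (2008), I §8 pp. 36–37, I §9 Thm. 9.1 (p. 42).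
* [MumfordAV1970] D. Mumford, *Abelian Varieties* (1970), §15 Thm. 1 (p. 143).
* [MumfordFogartyKirwan1994] D. Mumford, J. Fogarty, F. Kirwan, *Geometric Invariant Theory*, 3rd ed. (1994), Ch. 7 §2 Def. 7.2
  (p. 129), Def. 7.3 (p. 130).
-/

set_option autoImplicit false

noncomputable section

universe u

open CategoryTheory CategoryTheory.Limits AlgebraicGeometry MonoidalCategory
open scoped MonObj

namespace Literature.AlgebraicGeometry.AbelianSchemes

namespace AbelianSchemeOver

namespace DualPair

/-! ### §1 The dual transport of an isomorphism is the dual homomorphism of its inverse: `Ĥ_e = (e⁻¹)^∨` -/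

section HatTransportDual

variable {S : Scheme.{u}} {A A' : AbelianSchemeOver S} (D : A.DualPair) (D' : A'.DualPair) (e : A'.X ≅ A.X)
  [IsMonHom e.hom]

omit [IsMonHom e.hom] in
/-- `e⁻¹ × 1_{Â'}` (★ `transportMap`) is the base change `(e⁻¹)_{Â'}` of ★ `baseChangeHom` on underlying schemes (both are
`pullback.map _ _ _ _ e⁻¹ 𝟙 𝟙`). [cite: MilneAV2008, I §8 pp. 36–37] -/
theorem transportMap_eq_baseChangeHom_inv_left : transportMap D' e = (baseChangeHom e.inv D'.hat.X.hom).left := by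
  apply pullback.hom_ext
  · exact (transportMap_fst D' e).trans (baseChangeHom_left_comp_fst e.inv D'.hat.X.hom).symm
  · exact (transportMap_snd D' e).trans
      ((Over.w (baseChangeHom e.inv D'.hat.X.hom)).trans (Category.id_comp _).symm).symm

/-- **`Ĥ_e = (e⁻¹)^∨`**: the dual transport ★ `hatTransport D D' e : Â' → Â` of an isomorphism of `S`-group schemes
`e : A' ≅ A` IS the dual homomorphism ★ `dualIsogeny e⁻¹ D D'` of `e⁻¹ : A → A'` — both classify the family
`(e⁻¹ × 1)^*𝒫'` on `A ×_S Â'` ([MilneAV2008] I §8 «unique»; ★ `eq_dualIsogeny`). [cite: MilneAV2008, I §8 pp. 36–37]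
[cite: MumfordAV1970, §15 Thm. 1 (p. 143)] -/
theorem hatTransport_eq_dualIsogeny_inv : hatTransport D D' e = dualIsogeny e.inv D D' := by
  refine eq_dualIsogeny e.inv D D' (hatTransport D D' e) (hatTransport_comp_hom D D' e) ?_
  obtain ⟨i⟩ := nonempty_pullbackP_hatTransport_iso D D' e
  exact ⟨i ≪≫ (Scheme.Modules.pullbackCongr (transportMap_eq_baseChangeHom_inv_left D' e)).app D'.P⟩

/-- The same in `Over S`: `hatTransportOver D D' e = dualIsogenyOver e⁻¹ D D'`. [cite: MilneAV2008, I §8 pp. 36–37] -/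
theorem hatTransportOver_eq_dualIsogenyOver_inv : hatTransportOver D D' e = dualIsogenyOver e.inv D D' :=
  Over.OverMorphism.ext (by rw [hatTransportOver_left, dualIsogenyOver_left, hatTransport_eq_dualIsogeny_inv])

variable [IsReduced S] [IsLocallyNoetherian S]
  (hD : Nonempty ((Scheme.Modules.pullback (unitHatSlice D)).obj D.P ≅ SheafOfModules.unit _))

include hD in
/-- **`(e)^∨ ≫ Ĥ_e = 𝟙_{Â}`** (`Ĥ_e = (e⁻¹)^∨`, functoriality `(e⁻¹ ≫ e)^∨ = e^∨ ≫ (e⁻¹)^∨` ★ `dualIsogenyOver_comp`, and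
`(𝟙)^∨ = 𝟙` ★ `dualIsogenyOver_id'` over a reduced locally Noetherian base with `𝒫|_{A × {ε_Â}} ≅ 𝒪`).
[cite: MumfordAV1970, §15 Thm. 1 (p. 143)] [cite: MilneAV2008, I §9 Thm. 9.1 (p. 42)] -/
theorem dualIsogenyOver_hom_comp_hatTransportOver :
    dualIsogenyOver e.hom D' D ≫ hatTransportOver D D' e = 𝟙 D.hat.X := by
  rw [hatTransportOver_eq_dualIsogenyOver_inv, ← dualIsogenyOver_comp e.inv e.hom D D' D,
    dualIsogenyOver_congr D D (ψ₂ := 𝟙 A.X) (h₂ := inferInstance) e.inv_hom_id, dualIsogenyOver_id' D hD]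

include hD in
/-- **`Ĥ_e ≫ e^∨ = 𝟙_{Â'}`** (the other composite: `Ĥ_e` is an isomorphism ★ `isIso_hatTransportOver` with the one-sided
inverse `e^∨`). [cite: MumfordAV1970, §15 Thm. 1 (p. 143)] [cite: MilneAV2008, I §8 pp. 36–37] -/
theorem hatTransportOver_comp_dualIsogenyOver_hom :
    hatTransportOver D D' e ≫ dualIsogenyOver e.hom D' D = 𝟙 D'.hat.X := by
  haveI : IsMonHom e.symm.hom := (inferInstance : IsMonHom e.inv)
  haveI := isIso_hatTransportOver D D' e e.symm rfl
  rw [IsIso.eq_inv_of_inv_hom_id (dualIsogenyOver_hom_comp_hatTransportOver D D' e hD), IsIso.hom_inv_id]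

include hD in
/-- **THE `λ`-CLAUSE OF THE DUAL TRANSPORT FROM THE DUAL-HOMOMORPHISM FORM**: if `e ≫ λ ≫ e^∨ = λ'` (the polarisations
correspond EXACTLY under `e`, as ★ `Roof₀`∕`FrobCover₀`-type laws deliver it), then `λ' ≫ Ĥ_e = e ≫ λ` on underlying schemes —
the `λ`-clause of ★ `PolarizedAbelianSchemeWithLevel.IsBaseChangeVia` along `𝟙 S` for `(e, Ĥ_e)`. [cite: MumfordFogartyKirwan1994, Ch. 7 §2 Definition 7.2 (p. 129)]
[cite: MumfordAV1970, §15 Thm. 1 (p. 143)] -/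
theorem lam_left_comp_hatTransport_of_comp_dualIsogenyOver_eq (lam : A.X ⟶ D.hat.X) [IsMonHom lam] (lam' : A'.X ⟶ D'.hat.X)
    (h : e.hom ≫ lam ≫ dualIsogenyOver e.hom D' D = lam') :
    lam'.left ≫ hatTransport D D' e = e.hom.left ≫ lam.left := by
  rw [← h, ← hatTransportOver_left, ← Over.comp_left, ← Over.comp_left, Category.assoc, Category.assoc,
    dualIsogenyOver_hom_comp_hatTransportOver D D' e hD, Category.comp_id]

end HatTransportDual

end DualPair

end AbelianSchemeOver

end Literature.AlgebraicGeometry.AbelianSchemes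

end
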